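import Summits.QuantumFields.BalabanUV.T4Continuum.Support.BalabanHardMinimizer

/-!
# T⁴ programme, spine node NE2 (U1a) — the hard effective operator `Δ_K` versus the printed `Δ_k` of (1.65): the curl
# splitting of `Δ₀`, and the identification MODULO the typed gauge identity (1.95) «R∂*GQ* = 0»

Eighth generation of the NE2 prover lineage P1 of the cell `pub-balaban`, file 16 (companion of file 14
`Support/BalabanHardMinimizer`).  File 14 proved `⟨B, Δ_K B⟩ = η^d·min_{Q_kA = B} ⟨A, Δ₀A⟩` with `Δ₀ = Δ_a − aQ*Q` and the
minimiser `H B = 𝒢Q_kᴴ(n^d covB⁻¹)B` = «A = HB = GQ*(QGQ*)^{−1}B» ([Balaban1984PropagatorsII] (2.35)), and named the one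
identification step it did not take.  THIS FILE types that step:

* §1 `Delta0_eq_curl` — by the leaf's `DeltaA_eq_curl` ((1.69) first form «⟨A, Δ_aA⟩ = ⟨A, ∂*∂A⟩ + ⟨A, ∂R∂*A⟩ + a⟨A, Q*QA⟩»):
  `Δ₀ = ½·Curlᴴ Curl + ∂(1 − P)∂ᴴ`; `form_Delta0_split`: `⟨A, Δ₀A⟩ = ½⟨Curl A, Curl A⟩ + ⟨∂ᴴA, (1 − P)∂ᴴA⟩` — the first term
  is `η^{−d}·⟨∂A, ∂A⟩` of (1.21) «⟨∂A, ∂A⟩ = ½ Σ_{x∈T_η,μ,ν} η^d|F_{μν}(x)|²», the second the gauge term with `R = 1 − P`.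
* §2 **`Gauge195 n hn M a ha : Prop`** — the printed identity (1.95)/(2.34) «R∂*GQ* = 0, QG∂R = 0» (first half) for the CONCRETE
  lattice operators of the leaf, as the matrix identity `(1 − PcT)·GradOpᴴ·calG·QvOpᴴ = 0` (normalisations `η^{±d}` are
  irrelevant for `= 0`).  It is a TYPED INPUT, displayed by name, not discharged IN THIS FILE.  v1.0.1 ERRATUM: v1 said here
  that the tree certifies (1.95) only over abstract operator data — WRONG: the β cell's
  `Beta.LandauMultiplierIdentities.R_div_G_QvAdj_eq_zero` IS the concrete (1.95) (with `Q* = n^d·Q_kᴴ`), and the sequel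
  `Support/BalabanDeltaKIdentification` discharges `Gauge195` from it (`gauge195_holds`); likewise (1.103) `H_k = GQ*(QGQ*)⁻¹`
  (`Beta.FluctuationProjection.Hk`, `R_div_Hk`) and (1.65) with `Δ_k = (QGQ*)⁻¹ − a` (`Beta.BlockEffectiveAction.DelK`, `DelK_eq`)
  are in the tree.
* §3 consequences UNDER `Gauge195` (all [folklore] algebra): `R_div_Hk_of_gauge195` («R∂*H_kB = 0»);
  **`form_DeltaK_eq_curl_of_gauge195`**: `n^d·⟨B, Δ_K B⟩ = ½⟨Curl HB, Curl HB⟩`, i.e. `⟨B, Δ_K B⟩ = ⟨∂H_kB, ∂H_kB⟩_η` — the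
  DEFINING FORMULA (1.65) «⟨B, Δ_kB⟩ = ⟨∂H_kB, ∂H_kB⟩» of the printed `Δ_k`, with `H_k = HB` of (2.35); and
  **`curl_energy_Hk_le_of_gauge195`**: `½‖Curl HB‖² ≤ ½‖Curl A‖²` for every `A` with `Q_kA = B` and `R∂ᴴA = 0` — «H_kB is a
  minimum of ½⟨∂A, ∂A⟩ on {A: Q_kA = B, R∂*A = 0}» (p. 29).  So, GIVEN `Gauge195`, file 14's `Δ_K = covB⁻¹ − a` IS Bałaban's
  `Δ_k`, and files 13/14's η-rates are the η-rates of X8/X10/X11 at `U = 1`.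

HONEST FRAMING (T4-DAG p. 1).  §1 and §3 are [folklore] finite-dimensional algebra about the leaf's objects; §2 is a hypothesis
SHAPE (a `def … : Prop` with parameters), asserted by nobody in this file and PROVED in the tree by the β cell (see the ERRATUM
above; unconditional forms in `Support/BalabanDeltaKIdentification`); the printed sentences are quoted for orientation — none is
used as a hypothesis of an unconditional theorem.  `U = 1`, FIXED FINITE torus, linear layer; NOT `U ≠ 1` (WALL G-an2-4), NOT infinite
volume, NOT a mass gap, NOT Clay, NOT summit progress.  HONEST DEPENDENCY: continuum YM on T⁴ ⇐ BetaPertH ∧ nine spine estimates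
(0/9 proved); BetaPertH ⇐ (D1) ∧ (D4) ∧ CAP+tail; G-an2-4 gates asym, D1 and NE2/3/4.  ABSOLUTE RULE kept; no `sorry`.
-/

noncomputable section

open scoped BigOperators ComplexConjugate Matrix ComplexOrder Matrix.Norms.L2Operator
open Finset

namespace Summit.QuantumFields.BalabanUV.T4Continuum.BalabanHardMinimizerGauge

open Literature.MathematicalPhysics.QuantumFieldTheory.Balaban1983to89.B5Prop11Plancherel
open Literature.MathematicalPhysics.QuantumFieldTheory.Balaban1983to89.B5Prop11Inverse
open Literature.MathematicalPhysics.QuantumFieldTheory.Balaban1983to89.B5Prop11Lower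
open Literature.MathematicalPhysics.QuantumFieldTheory.Balaban1983to89.B5Block118
open Literature.MathematicalPhysics.QuantumFieldTheory.Balaban1983to89.B5QGQ171Unit
open Literature.MathematicalPhysics.QuantumFieldTheory.Balaban1983to89.B5DeltaA169
open Literature.MathematicalPhysics.QuantumFieldTheory.Balaban1983to89.B5Action121
open Literature.MathematicalPhysics.QuantumFieldTheory.Balaban1983to89.B5Value126 (PcT)
open Summit.QuantumFields.BalabanUV.T4Continuum.BalabanAveragedCoerciveFibre (star_dotProduct_conjTranspose_mulVec)
open Summit.QuantumFields.BalabanUV.T4Continuum.BalabanHardMinimizer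

variable {d : ℕ} (n : ℕ) [NeZero n] (hn : 1 ≤ n) (M : Fin d → ℕ) [hM : ∀ μ, NeZero (M μ)] (a : ℝ) (ha : 0 < a)

/-! ## §1 The curl splitting of `Δ₀` -/

/-- `Δ₀ = ½·Curlᴴ Curl + ∂(1 − P)∂ᴴ` — the first two terms «⟨A, ∂*∂A⟩ + ⟨A, ∂R∂*A⟩» of (1.69), `R = I − P`, with `∂*∂` on
vector functions `= ½(CurlOp)ᴴCurlOp` (the leaf's `DeltaA_eq_curl`). [cite: Balaban1984PropagatorsI, (1.69) p.29, (1.21) p.21] -/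
theorem Delta0_eq_curl :
    Delta0 n hn M a ha
      = (1 / 2 : ℂ) • ((CurlOp (fine n M) (n : ℂ))ᴴ * CurlOp (fine n M) (n : ℂ))
        + GradOp (fine n M) (n : ℂ) * (1 - PcT n M (n : ℂ)) * (GradOp (fine n M) (n : ℂ))ᴴ := by
  rw [Delta0, calDa_eq_DeltaA, DeltaA_eq_curl, add_sub_cancel_right]

/-- the form of `Δ₀` splits: `⟨A, Δ₀A⟩ = ½⟨Curl A, Curl A⟩ + ⟨∂ᴴA, (1 − P)∂ᴴA⟩` (`ℓ²` sums; the first term is `η^{−d}⟨∂A, ∂A⟩`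
of (1.21), the second the gauge term). [cite: Balaban1984PropagatorsI, (1.21) p.21, (1.69) p.29] -/
theorem form_Delta0_split (A : Tor (fine n M) × Fin d → ℂ) :
    star A ⬝ᵥ (Delta0 n hn M a ha *ᵥ A)
      = (1 / 2 : ℂ) * (star (CurlOp (fine n M) (n : ℂ) *ᵥ A) ⬝ᵥ (CurlOp (fine n M) (n : ℂ) *ᵥ A))
        + star ((GradOp (fine n M) (n : ℂ))ᴴ *ᵥ A)
            ⬝ᵥ ((1 - PcT n M (n : ℂ)) *ᵥ ((GradOp (fine n M) (n : ℂ))ᴴ *ᵥ A)) := by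
  rw [Delta0_eq_curl, Matrix.add_mulVec, Matrix.smul_mulVec, dotProduct_add, dotProduct_smul, smul_eq_mul,
    ← Matrix.mulVec_mulVec, star_dotProduct_conjTranspose_mulVec, ← Matrix.mulVec_mulVec, ← Matrix.mulVec_mulVec,
    star_conjTranspose_mulVec_dotProduct (GradOp (fine n M) (n : ℂ)) A]

/-! ## §2 The typed gauge identity (1.95) for the concrete operators -/

/-- **THE GAUGE IDENTITY (1.95), TYPED** for the leaf's concrete operators: `R∂*GQ* = 0` as `(1 − PcT)·GradOpᴴ·calG·QvOpᴴ = 0`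
(`R = 1 − P`, `P = PcT` (1.70), `∂* ∝ GradOpᴴ`, `G = calG`, `Q* ∝ QvOpᴴ`).  A hypothesis SHAPE, asserted by nobody in this file;
printed as «R∂*GQ* = 0, QG∂R = 0» and proved there (Sect. E); in the tree only over abstract operator data (`B5HkProperties`).
[cite: Balaban1984PropagatorsI, (1.95) p.33; Balaban1984PropagatorsII, (2.34) p.228 (shape of the input)] -/
def Gauge195 : Prop :=
  (1 - PcT n M (n : ℂ)) * (GradOp (fine n M) (n : ℂ))ᴴ * calG n hn M a ha * (QvOp n M)ᴴ = 0

/-! ## §3 Consequences under `Gauge195`: `Δ_K` is the printed `Δ_k` -/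

/-- under (1.95): «R∂*H_kB = 0» for `H = 𝒢Q_kᴴ(n^d covB⁻¹)`. [cite: Balaban1984PropagatorsI, p.29 (statement); proof ours,
conditional] -/
theorem R_div_Hk_of_gauge195 (h : Gauge195 n hn M a ha) (B : Tor M × Fin d → ℂ) :
    (1 - PcT n M (n : ℂ)) *ᵥ ((GradOp (fine n M) (n : ℂ))ᴴ *ᵥ Hk n hn M a ha B) = 0 := by
  rw [Hk, Matrix.mulVec_mulVec, Matrix.mulVec_mulVec, Matrix.mulVec_mulVec, h, Matrix.zero_mulVec]

/-- **(1.65) UNDER (1.95)**: `n^d·⟨B, Δ_K B⟩ = ½⟨Curl HB, Curl HB⟩`, i.e. `⟨B, Δ_K B⟩ = η^d·½Σ|F_{μν}(HB)|² = ⟨∂H_kB, ∂H_kB⟩` —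
the defining formula «⟨B, Δ_kB⟩ = ⟨∂H_kB, ∂H_kB⟩» of the printed `Δ_k` holds for file 14's `Δ_K = covB⁻¹ − a`, GIVEN the typed
gauge identity. [cite: Balaban1984PropagatorsI, (1.65) p.29, (1.21) p.21 (statement); proof ours, conditional] -/
theorem form_DeltaK_eq_curl_of_gauge195 (h : Gauge195 n hn M a ha) (B : Tor M × Fin d → ℂ) :
    ((n : ℂ) ^ d) * (star B ⬝ᵥ (DeltaK n hn M a ha *ᵥ B))
      = (1 / 2 : ℂ) * (star (CurlOp (fine n M) (n : ℂ) *ᵥ Hk n hn M a ha B)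
          ⬝ᵥ (CurlOp (fine n M) (n : ℂ) *ᵥ Hk n hn M a ha B)) := by
  rw [← form_Delta0_Hk, form_Delta0_split, R_div_Hk_of_gauge195 n hn M a ha h B, dotProduct_zero, add_zero]

/-- **«H_kB is a minimum of ½⟨∂A, ∂A⟩ on {A : Q_kA = B, R∂*A = 0}» UNDER (1.95)**: for every fine `A` with `Q_kA = B` and
`(1 − P)∂ᴴA = 0`, `½·Re⟨Curl HB, Curl HB⟩ ≤ ½·Re⟨Curl A, Curl A⟩` (from file 14's exact identity `form_Delta0_eq` and
`Δ_a ⪰ 0`). [cite: Balaban1984PropagatorsI, p.29 (statement); proof ours, conditional] -/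
theorem curl_energy_Hk_le_of_gauge195 (h : Gauge195 n hn M a ha) (A : Tor (fine n M) × Fin d → ℂ) (B : Tor M × Fin d → ℂ)
    (hA : QvOp n M *ᵥ A = B) (hg : (1 - PcT n M (n : ℂ)) *ᵥ ((GradOp (fine n M) (n : ℂ))ᴴ *ᵥ A) = 0) :
    ((1 / 2 : ℂ) * (star (CurlOp (fine n M) (n : ℂ) *ᵥ Hk n hn M a ha B)
        ⬝ᵥ (CurlOp (fine n M) (n : ℂ) *ᵥ Hk n hn M a ha B))).re
      ≤ ((1 / 2 : ℂ) * (star (CurlOp (fine n M) (n : ℂ) *ᵥ A) ⬝ᵥ (CurlOp (fine n M) (n : ℂ) *ᵥ A))).re := by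
  have h1 := form_Delta0_eq n hn M a ha A B hA
  rw [form_Delta0_split, hg, dotProduct_zero, add_zero, form_DeltaK_eq_curl_of_gauge195 n hn M a ha h B] at h1
  have hsq : 0 ≤ (star (A - Hk n hn M a ha B) ⬝ᵥ (calDa n hn M a ha *ᵥ (A - Hk n hn M a ha B))).re :=
    form_re_nonneg_of_posSemidef (calDa_posSemidef n hn M a ha) _
  have h2 := congrArg Complex.re h1
  rw [Complex.add_re] at h2
  linarith

/-- the same, packaged: under `Gauge195`, `HB` satisfies ALL THREE printed properties of `H_kB` — «Q_kH_kB = B» (unconditional,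
file 14), «R∂*H_kB = 0», and minimality of `½⟨∂A, ∂A⟩` on the printed hyperplane — and `Δ_K`'s form is (1.65)'s.
[cite: Balaban1984PropagatorsI, p.29, (1.65) (statements); proofs ours, conditional on the typed (1.95)] -/
theorem hk_props_of_gauge195 (h : Gauge195 n hn M a ha) (B : Tor M × Fin d → ℂ) :
    QvOp n M *ᵥ Hk n hn M a ha B = B ∧
      (1 - PcT n M (n : ℂ)) *ᵥ ((GradOp (fine n M) (n : ℂ))ᴴ *ᵥ Hk n hn M a ha B) = 0 ∧
      (∀ A : Tor (fine n M) × Fin d → ℂ, QvOp n M *ᵥ A = B →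
        (1 - PcT n M (n : ℂ)) *ᵥ ((GradOp (fine n M) (n : ℂ))ᴴ *ᵥ A) = 0 →
          ((1 / 2 : ℂ) * (star (CurlOp (fine n M) (n : ℂ) *ᵥ Hk n hn M a ha B)
              ⬝ᵥ (CurlOp (fine n M) (n : ℂ) *ᵥ Hk n hn M a ha B))).re
            ≤ ((1 / 2 : ℂ) * (star (CurlOp (fine n M) (n : ℂ) *ᵥ A) ⬝ᵥ (CurlOp (fine n M) (n : ℂ) *ᵥ A))).re) ∧
      ((n : ℂ) ^ d) * (star B ⬝ᵥ (DeltaK n hn M a ha *ᵥ B))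
        = (1 / 2 : ℂ) * (star (CurlOp (fine n M) (n : ℂ) *ᵥ Hk n hn M a ha B)
            ⬝ᵥ (CurlOp (fine n M) (n : ℂ) *ᵥ Hk n hn M a ha B)) :=
  ⟨QvOp_mulVec_Hk n hn M a ha B, R_div_Hk_of_gauge195 n hn M a ha h B,
    fun A hA hg => curl_energy_Hk_le_of_gauge195 n hn M a ha h A B hA hg, form_DeltaK_eq_curl_of_gauge195 n hn M a ha h B⟩

end Summit.QuantumFields.BalabanUV.T4Continuum.BalabanHardMinimizerGauge

end
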